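import Literature.Probability.RandomPlanarGeometry.SAWCountMonotoneWitnesses
import Literature.Probability.RandomPlanarGeometry.SAWCountMonotoneOdd
import HarnessLib

/-!
# Doubly trapped walks exist at EVERY odd length `n ≥ 6d - 3`, in EVERY dimension `d ≥ 2`:
# the odd half of the threshold law for O'Brien's reversal route, as an iff

Companion of `SAWCountMonotoneOdd.lean` and `SAWCountMonotoneWitnesses.lean` (lane «pcv-sawmu»,
door «O'BRIEN» = the tree's named fact `BDGS2012_count_mono`, `cₙ ≤ cₙ₊₁` on `ℤ^d`, O'Brien 1990).
`SAWCountMonotoneReversal.lean` reduces O'Brien's inequality to the set `T₂ = doublyTrapped d n` of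
`n`-step self-avoiding walks with a trapped END and at most one free site at the START
(`cₙ ≤ cₙ₊₁ + #T₂`); `SAWCountMonotoneOdd.lean` proves `T₂ = ∅` for every odd `n ≤ 6d - 5` (all `d`),
and `SAWCountMonotoneWitnesses.lean` exhibits doubly trapped walks at the threshold `n = 6d - 3` for
`d = 2, …, 6` by kernel evaluation.  Here the construction behind those witnesses is carried out
uniformly in the dimension and padded to every larger odd length:

* `oddWitness m k` : an explicit `(6m + 9 + 2k)`-step walk on `ℤ^{m+2}` (spine `-(k+1)e₀ … 2e₀`,
  rungs `{±eₐ, e₀ ± eₐ}` over the `2m + 2` signed lateral unit vectors joined by corners, end `e₀`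
  with all its `2(m+2)` neighbours visited, start `0` with exactly one free neighbour);
* `oddWitness_mem_doublyTrapped` : it lies in `T₂(m+2, 6m+9+2k)`;
* `doublyTrapped_nonempty_of_odd` : **`T₂(d, n) ≠ ∅` for every `d ≥ 2` and every odd `n` with
  `6d ≤ n + 3`**;
* `doublyTrapped_eq_empty_iff_of_odd` : for `d ≥ 2` and odd `n`, **`T₂(d, n) = ∅ ↔ n + 5 ≤ 6d`** —
  the reversal pairing proves O'Brien's inequality at an odd length exactly when `n ≤ 6d - 5`.

The even half (`8d - 6`, petals around `e₀ + e₁`) is the sibling module `SAWCountMonotoneSharpEven`.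
No named facts are introduced; the walks and their bookkeeping are lane constructions
(`FINDING-OBRIEN-THRESHOLD-LAW.md`), the vocabulary is Madras–Slade §1.1.

[cite: MadrasSlade1993, §1.1 (self-avoiding walks on `ℤ^d`); §7.1 p. 231 (`c_{N+1} ≥ c_N`, O'Brien)]
[cite: BDGS2012, §1.3 (`cₙ ≤ cₙ₊₁`, O'Brien 1990)]
-/

open Literature.Probability.LatticeModels Literature.Probability.Percolation SimpleGraph

namespace Literature.Probability.RandomPlanarGeometry.SAW.Zd

/-! ### Coordinates of `ℤ^{m+2}`: the spine axis `0` and signed lateral unit vectors -/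

/-- The coordinate index `min a (m+1)` of `ℤ^{m+2}` (the clamp keeps the index total; it is the
identity on `a ≤ m + 1`). [cite: MadrasSlade1993, §1.1] -/
def axisFin (m a : ℕ) : Fin (m + 2) := ⟨min a (m + 1), by omega⟩

/-- `axisFin m a = a` as a natural number when `a ≤ m + 1`. [cite: MadrasSlade1993, §1.1] -/
theorem axisFin_val {m a : ℕ} (h : a ≤ m + 1) : (axisFin m a : ℕ) = a := by
  simp [axisFin, h]

/-- `axisFin` is injective on `[0, m+1]`. [cite: MadrasSlade1993, §1.1] -/
theorem axisFin_eq_iff {m a b : ℕ} (ha : a ≤ m + 1) (hb : b ≤ m + 1) :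
    axisFin m a = axisFin m b ↔ a = b := by
  simp [Fin.ext_iff, axisFin, min_eq_left ha, min_eq_left hb]

/-- `axisFin m a ≠ axisFin m 0` for `a ≥ 1`. [cite: MadrasSlade1993, §1.1] -/
theorem axisFin_ne_zero {m a : ℕ} (ha : 1 ≤ a) : axisFin m a ≠ axisFin m 0 := by
  intro h
  have := congrArg Fin.val h
  simp [axisFin] at this
  omega

/-- The point `c e₀` of the spine axis. [cite: MadrasSlade1993, §1.1] -/
def spinePt (m : ℕ) (c : ℤ) : Site (m + 2) := Pi.single (axisFin m 0) c

/-- The spine coordinate `x₀` of a site. [cite: MadrasSlade1993, §1.1] -/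
def spineCoord (m : ℕ) (x : Site (m + 2)) : ℤ := x (axisFin m 0)

/-- A system of `2p` signed lateral unit vectors on the axes `o, …, o + p - 1`:
`latVec m p o j = e_{o+j}` for `j < p` and `= -e_{o+j-p}` for `p ≤ j < 2p`. [cite: MadrasSlade1993, §1.1] -/
def latVec (m p o j : ℕ) : Site (m + 2) :=
  if j < p then Pi.single (axisFin m (o + j)) 1 else -Pi.single (axisFin m (o + j - p)) 1

/-- The signed coordinate functional dual to `latVec m p o j` (`+x_{o+j}`, resp. `-x_{o+j-p}`).
[cite: MadrasSlade1993, §1.1] -/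
def latFun (m p o j : ℕ) (x : Site (m + 2)) : ℤ :=
  if j < p then x (axisFin m (o + j)) else -x (axisFin m (o + j - p))

section Coordinates

variable {m p o : ℕ}

/-- `spineCoord` is additive. [cite: MadrasSlade1993, §1.1] -/
@[simp] theorem spineCoord_add (x y : Site (m + 2)) :
    spineCoord m (x + y) = spineCoord m x + spineCoord m y := rfl

/-- `spineCoord` of a negative. [cite: MadrasSlade1993, §1.1] -/
@[simp] theorem spineCoord_neg (x : Site (m + 2)) : spineCoord m (-x) = -spineCoord m x := rfl

/-- `spineCoord (c e₀) = c`. [cite: MadrasSlade1993, §1.1] -/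
@[simp] theorem spineCoord_spinePt (c : ℤ) : spineCoord m (spinePt m c) = c := by
  simp [spineCoord, spinePt]

/-- Lateral vectors have spine coordinate `0` (for `o ≥ 1`). [cite: MadrasSlade1993, §1.1] -/
@[simp] theorem spineCoord_latVec (ho : 1 ≤ o) (j : ℕ) : spineCoord m (latVec m p o j) = 0 := by
  unfold spineCoord latVec
  split_ifs with h
  · rw [Pi.single_eq_of_ne (axisFin_ne_zero (by omega)).symm]
  · rw [Pi.neg_apply, Pi.single_eq_of_ne (axisFin_ne_zero (by omega)).symm, neg_zero]

/-- `latFun` is additive. [cite: MadrasSlade1993, §1.1] -/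
@[simp] theorem latFun_add (j : ℕ) (x y : Site (m + 2)) :
    latFun m p o j (x + y) = latFun m p o j x + latFun m p o j y := by
  unfold latFun; split_ifs <;> simp [Pi.add_apply]; ring

/-- `latFun` of a negative. [cite: MadrasSlade1993, §1.1] -/
@[simp] theorem latFun_neg (j : ℕ) (x : Site (m + 2)) :
    latFun m p o j (-x) = -latFun m p o j x := by
  unfold latFun; split_ifs <;> simp [Pi.neg_apply]

/-- `latFun j (c e₀) = 0` (for `o ≥ 1`). [cite: MadrasSlade1993, §1.1] -/
@[simp] theorem latFun_spinePt (ho : 1 ≤ o) (j : ℕ) (c : ℤ) : latFun m p o j (spinePt m c) = 0 := by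
  unfold latFun spinePt
  split_ifs with h
  · rw [Pi.single_eq_of_ne (axisFin_ne_zero (by omega))]
  · rw [Pi.single_eq_of_ne (axisFin_ne_zero (by omega)), neg_zero]

/-- `latFun j (latVec j) = 1`. [cite: MadrasSlade1993, §1.1] -/
@[simp] theorem latFun_latVec_self (j : ℕ) : latFun m p o j (latVec m p o j) = 1 := by
  unfold latFun latVec
  split_ifs with h <;> simp

/-- Closed form of `latFun j (latVec i)`: `1` on the diagonal, `-1` for antipodal indices
(`|i - j| = p`), `0` otherwise (indices `< 2p`, axes inside `ℤ^{m+2}`). [cite: MadrasSlade1993, §1.1] -/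
theorem latFun_latVec (hop : o + p ≤ m + 2) {i j : ℕ} (hi : i < 2 * p) (hj : j < 2 * p) :
    latFun m p o j (latVec m p o i) = if i = j then 1 else if i + p = j ∨ j + p = i then -1 else 0 := by
  unfold latFun latVec
  by_cases ha : j < p <;> by_cases hb : i < p <;>
    simp (disch := omega) only [ha, hb, if_true, if_false, Pi.single_apply, Pi.neg_apply,
      axisFin_eq_iff] <;>
    split_ifs <;> omega

/-- `latFun j (latVec i) ≤ 0` for `i ≠ j` (both `< 2p`, axes inside `ℤ^{m+2}`). [cite: MadrasSlade1993, §1.1] -/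
theorem latFun_latVec_le (hop : o + p ≤ m + 2) {i j : ℕ} (hi : i < 2 * p) (hj : j < 2 * p)
    (hij : i ≠ j) : latFun m p o j (latVec m p o i) ≤ 0 := by
  rw [latFun_latVec hop hi hj]
  split_ifs <;> omega

/-- `latFun j (latVec i) = 0` unless `i` and `j` are equal or antipodal (`|i - j| = p`).
[cite: MadrasSlade1993, §1.1] -/
theorem latFun_latVec_eq_zero (hop : o + p ≤ m + 2) {i j : ℕ} (hi : i < 2 * p) (hj : j < 2 * p)
    (hij : i ≠ j) (h1 : i + p ≠ j) (h2 : j + p ≠ i) : latFun m p o j (latVec m p o i) = 0 := by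
  rw [latFun_latVec hop hi hj]
  split_ifs <;> omega

/-- Adjacency along the spine: `x ∼ x + e₀`. [cite: MadrasSlade1993, §1.1] -/
theorem adj_add_spinePt_one (x : Site (m + 2)) : (zdGraph (m + 2)).Adj x (x + spinePt m 1) :=
  (zdGraph_adj_iff _ _).2 ⟨axisFin m 0, Or.inl rfl⟩

/-- Adjacency along the spine: `x + e₀ ∼ x`. [cite: MadrasSlade1993, §1.1] -/
theorem adj_add_spinePt_one' (x : Site (m + 2)) : (zdGraph (m + 2)).Adj (x + spinePt m 1) x :=
  (adj_add_spinePt_one x).symm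

/-- Adjacency along a lateral: `x ∼ x + latVec j`. [cite: MadrasSlade1993, §1.1] -/
theorem adj_add_latVec (x : Site (m + 2)) (j : ℕ) : (zdGraph (m + 2)).Adj x (x + latVec m p o j) := by
  unfold latVec
  split_ifs with h
  · exact (zdGraph_adj_iff _ _).2 ⟨_, Or.inl rfl⟩
  · exact (zdGraph_adj_iff _ _).2 ⟨axisFin m (o + j - p), Or.inr (by abel)⟩

/-- Adjacency along a lateral: `x + latVec j ∼ x`. [cite: MadrasSlade1993, §1.1] -/
theorem adj_add_latVec' (x : Site (m + 2)) (j : ℕ) : (zdGraph (m + 2)).Adj (x + latVec m p o j) x :=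
  (adj_add_latVec x j).symm

end Coordinates

/-! ### The odd witness: an explicit doubly trapped walk of length `6m + 9 + 2k` on `ℤ^{m+2}` -/

/-- The `j`-th signed lateral unit vector of the odd witness, `j = 0, …, 2m+1`:
`e₁, …, e_{m+1}, -e₁, …, -e_{m+1}`. [cite: MadrasSlade1993, §1.1] -/
def oddLat (m j : ℕ) : Site (m + 2) := latVec m (m + 1) 1 j

/-- The signed coordinate dual to `oddLat m j`. [cite: MadrasSlade1993, §1.1] -/
def oddFun (m j : ℕ) (x : Site (m + 2)) : ℤ := latFun m (m + 1) 1 j x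

/-- The six sites after the padded start: `e₁, e₀+e₁, 2e₀+e₁, 2e₀, 2e₀+v₁, e₀+v₁` (`v₁ = oddLat m 1`).
[cite: BDGS2012, §1.3] -/
def oddHead (m s : ℕ) : Site (m + 2) :=
  if s = 0 then oddLat m 0
  else if s = 1 then spinePt m 1 + oddLat m 0
  else if s = 2 then spinePt m 2 + oddLat m 0
  else if s = 3 then spinePt m 2
  else if s = 4 then spinePt m 2 + oddLat m 1
  else spinePt m 1 + oddLat m 1

/-- The three sites of rung `j` (`2 ≤ j ≤ 2m+1`): for even `j` the corner `e₀ + v_{j-1} + v_j`, then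
`e₀ + v_j`, `v_j` (downwards); for odd `j` the corner `v_{j-1} + v_j`, then `v_j`, `e₀ + v_j` (upwards).
[cite: BDGS2012, §1.3] -/
def oddRung (m j r : ℕ) : Site (m + 2) :=
  if j % 2 = 0 then
    (if r = 0 then spinePt m 1 + oddLat m (j - 1) + oddLat m j
      else if r = 1 then spinePt m 1 + oddLat m j else oddLat m j)
  else
    (if r = 0 then oddLat m (j - 1) + oddLat m j
      else if r = 1 then oddLat m j else spinePt m 1 + oddLat m j)

/-- **The odd witness** on `ℤ^{m+2}` with padding `k`: `0, -e₀, …, -(k+1)e₀` (spine out),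
`-(k+1)e₀ + e₁, …, -e₀ + e₁` (back along the first lateral), the six head sites, the rungs
`j = 2, …, 2m+1`, and the end `e₀`; frozen after time `6m + 9 + 2k`. [cite: BDGS2012, §1.3] -/
def oddWitness (m k : ℕ) (t : ℕ) : Site (m + 2) :=
  if t ≤ k + 1 then spinePt m (-(t : ℤ))
  else if t ≤ 2 * k + 2 then spinePt m ((t : ℤ) - (2 * k + 3)) + oddLat m 0
  else if t < 2 * k + 9 then oddHead m (t - (2 * k + 3))
  else if t ≤ 2 * k + 6 * m + 8 then oddRung m ((t - (2 * k + 3)) / 3) ((t - (2 * k + 3)) % 3)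
  else spinePt m 1

section OddWitness

variable {m k : ℕ}

/-! #### Values -/

/-- Spine phase. [cite: BDGS2012, §1.3] -/
theorem oddWitness_of_le_succ {t : ℕ} (ht : t ≤ k + 1) : oddWitness m k t = spinePt m (-(t : ℤ)) := by
  simp [oddWitness, ht]

/-- Return leg. [cite: BDGS2012, §1.3] -/
theorem oddWitness_leg {t : ℕ} (h1 : k + 2 ≤ t) (h2 : t ≤ 2 * k + 2) :
    oddWitness m k t = spinePt m ((t : ℤ) - (2 * k + 3)) + oddLat m 0 := by
  simp [oddWitness, show ¬ t ≤ k + 1 by omega, h2]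

/-- Head phase. [cite: BDGS2012, §1.3] -/
theorem oddWitness_head {s : ℕ} (hs : s < 6) : oddWitness m k (2 * k + 3 + s) = oddHead m s := by
  simp [oddWitness, show ¬ 2 * k + 3 + s ≤ k + 1 by omega, show ¬ 2 * k + 3 + s ≤ 2 * k + 2 by omega,
    show 2 * k + 3 + s < 2 * k + 9 by omega]

/-- Rung phase. [cite: BDGS2012, §1.3] -/
theorem oddWitness_rung {j r : ℕ} (hj : 2 ≤ j) (hj' : j ≤ 2 * m + 1) (hr : r < 3) :
    oddWitness m k (2 * k + 3 * j + 3 + r) = oddRung m j r := by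
  have h1 : ¬ 2 * k + 3 * j + 3 + r ≤ k + 1 := by omega
  have h2 : ¬ 2 * k + 3 * j + 3 + r ≤ 2 * k + 2 := by omega
  have h3 : ¬ 2 * k + 3 * j + 3 + r < 2 * k + 9 := by omega
  have h4 : 2 * k + 3 * j + 3 + r ≤ 2 * k + 6 * m + 8 := by omega
  have h5 : (2 * k + 3 * j + 3 + r - (2 * k + 3)) / 3 = j := by omega
  have h6 : (2 * k + 3 * j + 3 + r - (2 * k + 3)) % 3 = r := by omega
  simp [oddWitness, h1, h2, h3, h4, h5, h6]

/-- End phase (frozen at `e₀`). [cite: BDGS2012, §1.3] -/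
theorem oddWitness_of_ge {t : ℕ} (ht : 2 * k + 6 * m + 9 ≤ t) : oddWitness m k t = spinePt m 1 := by
  simp [oddWitness, show ¬ t ≤ k + 1 by omega, show ¬ t ≤ 2 * k + 2 by omega,
    show ¬ t < 2 * k + 9 by omega, show ¬ t ≤ 2 * k + 6 * m + 8 by omega]

/-- Every time `t ≤ 6m + 9 + 2k` lies in one of the five phases. [cite: BDGS2012, §1.3] -/
theorem oddWitness_zones {t : ℕ} (ht : t ≤ 2 * k + 6 * m + 9) :
    t ≤ k + 1 ∨ (k + 2 ≤ t ∧ t ≤ 2 * k + 2) ∨ (∃ s, s < 6 ∧ t = 2 * k + 3 + s) ∨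
      (∃ j r, 2 ≤ j ∧ j ≤ 2 * m + 1 ∧ r < 3 ∧ t = 2 * k + 3 * j + 3 + r) ∨ t = 2 * k + 6 * m + 9 := by
  rcases Nat.lt_or_ge t (k + 2) with h | h
  · exact Or.inl (by omega)
  rcases Nat.lt_or_ge t (2 * k + 3) with h' | h'
  · exact Or.inr (Or.inl ⟨h, by omega⟩)
  rcases Nat.lt_or_ge t (2 * k + 9) with h'' | h''
  · exact Or.inr (Or.inr (Or.inl ⟨t - (2 * k + 3), by omega, by omega⟩))
  rcases Nat.lt_or_ge t (2 * k + 6 * m + 9) with h3 | h3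
  · refine Or.inr (Or.inr (Or.inr (Or.inl ⟨(t - (2 * k + 9)) / 3 + 2, (t - (2 * k + 9)) % 3,
      by omega, by omega, Nat.mod_lt _ (by norm_num), by omega⟩)))
  · exact Or.inr (Or.inr (Or.inr (Or.inr (by omega))))

/-! #### Statistics: the spine coordinate and the lateral functionals along the walk -/

/-- `spinePt m a + spinePt m b = spinePt m (a + b)`. [cite: MadrasSlade1993, §1.1] -/
theorem spinePt_add (a b : ℤ) : spinePt m a + spinePt m b = spinePt m (a + b) := by
  simp [spinePt, Pi.single_add]

/-- `spinePt m 0 = 0`. [cite: MadrasSlade1993, §1.1] -/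
@[simp] theorem spinePt_zero : spinePt m 0 = 0 := by simp [spinePt]

/-- `oddFun j` is additive. [cite: MadrasSlade1993, §1.1] -/
@[simp] theorem oddFun_add (j : ℕ) (x y : Site (m + 2)) :
    oddFun m j (x + y) = oddFun m j x + oddFun m j y := latFun_add j x y

/-- `oddFun j (c e₀) = 0`. [cite: MadrasSlade1993, §1.1] -/
@[simp] theorem oddFun_spinePt (j : ℕ) (c : ℤ) : oddFun m j (spinePt m c) = 0 :=
  latFun_spinePt le_rfl j c

/-- `oddFun j (oddLat j) = 1`. [cite: MadrasSlade1993, §1.1] -/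
@[simp] theorem oddFun_oddLat_self (j : ℕ) : oddFun m j (oddLat m j) = 1 := latFun_latVec_self j

/-- `oddFun j (oddLat i) ≤ 0` for `i ≠ j` (indices `≤ 2m + 1`). [cite: MadrasSlade1993, §1.1] -/
theorem oddFun_oddLat_le {i j : ℕ} (hi : i ≤ 2 * m + 1) (hj : j ≤ 2 * m + 1) (hij : i ≠ j) :
    oddFun m j (oddLat m i) ≤ 0 :=
  latFun_latVec_le (by omega) (by omega) (by omega) hij

/-- Consecutive laterals are orthogonal: `oddFun j (oddLat (j-1)) = 0 = oddFun (j-1) (oddLat j)` for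
`2 ≤ j ≤ 2m+1` (this needs `m ≥ 1`, which `2 ≤ 2m+1` forces). [cite: MadrasSlade1993, §1.1] -/
theorem oddFun_oddLat_pred {j : ℕ} (hj : 2 ≤ j) (hj' : j ≤ 2 * m + 1) :
    oddFun m j (oddLat m (j - 1)) = 0 ∧ oddFun m (j - 1) (oddLat m j) = 0 :=
  ⟨latFun_latVec_eq_zero (by omega) (by omega) (by omega) (by omega) (by omega) (by omega),
    latFun_latVec_eq_zero (by omega) (by omega) (by omega) (by omega) (by omega) (by omega)⟩

/-- The spine coordinate of a lateral vanishes. [cite: MadrasSlade1993, §1.1] -/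
@[simp] theorem spineCoord_oddLat (j : ℕ) : spineCoord m (oddLat m j) = 0 := spineCoord_latVec le_rfl j


/-- Spine coordinate of the head sites: `0, 1, 2, 2, 2, 1`. [cite: BDGS2012, §1.3] -/
theorem spineCoord_oddHead (s : ℕ) :
    spineCoord m (oddHead m s) = if s = 0 then 0 else if s = 1 then 1 else if s ≤ 4 then 2 else 1 := by
  unfold oddHead
  by_cases h0 : s = 0; · subst h0; simp
  by_cases h1 : s = 1; · subst h1; simp
  by_cases h2 : s = 2; · subst h2; simp
  by_cases h3 : s = 3; · subst h3; simp
  by_cases h4 : s = 4; · subst h4; simp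
  simp [h0, h1, h2, h3, h4, show ¬ s ≤ 4 by omega]

/-- Lateral functionals of the head sites. [cite: BDGS2012, §1.3] -/
theorem oddFun_oddHead (i s : ℕ) :
    oddFun m i (oddHead m s) =
      if s ≤ 2 then oddFun m i (oddLat m 0) else if s = 3 then 0 else oddFun m i (oddLat m 1) := by
  unfold oddHead
  by_cases h0 : s = 0; · subst h0; simp
  by_cases h1 : s = 1; · subst h1; simp
  by_cases h2 : s = 2; · subst h2; simp
  by_cases h3 : s = 3; · subst h3; simp
  by_cases h4 : s = 4; · subst h4; simp
  simp [h0, h1, h2, h3, h4, show ¬ s ≤ 2 by omega]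

/-- Spine coordinate of the rung sites. [cite: BDGS2012, §1.3] -/
theorem spineCoord_oddRung (j r : ℕ) :
    spineCoord m (oddRung m j r) =
      if j % 2 = 0 then (if r ≤ 1 then 1 else 0) else (if r ≤ 1 then 0 else 1) := by
  unfold oddRung
  by_cases hj : j % 2 = 0 <;> by_cases h0 : r = 0 <;> by_cases h1 : r = 1 <;>
    simp [hj, h0, h1] <;> omega

/-- Lateral functionals of the rung sites. [cite: BDGS2012, §1.3] -/
theorem oddFun_oddRung (i j r : ℕ) :
    oddFun m i (oddRung m j r) =
      (if r = 0 then oddFun m i (oddLat m (j - 1)) else 0) + oddFun m i (oddLat m j) := by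
  unfold oddRung
  by_cases hj : j % 2 = 0 <;> by_cases h0 : r = 0 <;> by_cases h1 : r = 1 <;> simp [hj, h0, h1]

/-- Before rung `j` starts, the functional `oddFun j` is `≤ 0` along the walk; on rung `j` it is `1`.
This is the freshness invariant behind self-avoidance. [cite: BDGS2012, §1.3] -/
theorem oddFun_oddWitness_nonpos {j t : ℕ} (hj : 2 ≤ j) (hj' : j ≤ 2 * m + 1)
    (ht : t < 2 * k + 3 * j + 3) : oddFun m j (oddWitness m k t) ≤ 0 := by
  have h0 : oddFun m j (oddLat m 0) ≤ 0 := oddFun_oddLat_le (by omega) hj' (by omega)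
  have h1 : oddFun m j (oddLat m 1) ≤ 0 := oddFun_oddLat_le (by omega) hj' (by omega)
  rcases oddWitness_zones (m := m) (k := k) (t := t) (by omega) with
      hA | ⟨hB1, hB2⟩ | ⟨s, hs, rfl⟩ | ⟨j', r', hj1, hj2, hr, rfl⟩ | hE
  · rw [oddWitness_of_le_succ hA, oddFun_spinePt]
  · rw [oddWitness_leg hB1 hB2, oddFun_add, oddFun_spinePt, zero_add]; exact h0
  · rw [oddWitness_head hs, oddFun_oddHead]
    split_ifs
    · exact h0
    · exact le_rfl
    · exact h1
  · rw [oddWitness_rung hj1 hj2 hr, oddFun_oddRung]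
    have hlt : j' < j := by omega
    have ha : oddFun m j (oddLat m j') ≤ 0 := oddFun_oddLat_le hj2 hj' (by omega)
    have hb : oddFun m j (oddLat m (j' - 1)) ≤ 0 := oddFun_oddLat_le (by omega) hj' (by omega)
    split_ifs
    · linarith
    · linarith
  · omega

/-- On rung `j` the functional `oddFun j` equals `1`. [cite: BDGS2012, §1.3] -/
theorem oddFun_oddRung_self {j : ℕ} (hj : 2 ≤ j) (hj' : j ≤ 2 * m + 1) (r : ℕ) :
    oddFun m j (oddRung m j r) = 1 := by
  rw [oddFun_oddRung, (oddFun_oddLat_pred hj hj').1, oddFun_oddLat_self]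
  split_ifs <;> simp

/-- On rung `j` the functional `oddFun (j-1)` marks the corner. [cite: BDGS2012, §1.3] -/
theorem oddFun_pred_oddRung {j : ℕ} (hj : 2 ≤ j) (hj' : j ≤ 2 * m + 1) (r : ℕ) :
    oddFun m (j - 1) (oddRung m j r) = if r = 0 then 1 else 0 := by
  rw [oddFun_oddRung, (oddFun_oddLat_pred hj hj').2, oddFun_oddLat_self]
  split_ifs <;> simp

/-- Up to the head site `2e₀` the functional `oddFun 1` is `≤ 0`. [cite: BDGS2012, §1.3] -/
theorem oddFun_one_oddWitness_nonpos {t : ℕ} (ht : t ≤ 2 * k + 6) :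
    oddFun m 1 (oddWitness m k t) ≤ 0 := by
  have h0 : oddFun m 1 (oddLat m 0) ≤ 0 := oddFun_oddLat_le (by omega) (by omega) (by omega)
  rcases oddWitness_zones (m := m) (k := k) (t := t) (by omega) with
      hA | ⟨hB1, hB2⟩ | ⟨s, hs, rfl⟩ | ⟨j', r', hj1, hj2, hr, h⟩ | hE
  · rw [oddWitness_of_le_succ hA, oddFun_spinePt]
  · rw [oddWitness_leg hB1 hB2, oddFun_add, oddFun_spinePt, zero_add]; exact h0
  · rw [oddWitness_head hs, oddFun_oddHead]
    have hs3 : s ≤ 3 := by omega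
    split_ifs
    · exact h0
    · exact le_rfl
    · omega
  · omega
  · omega

/-- Up to the head site `e₁` the spine coordinate is `≤ 0`; at the next one it is `≤ 1`.
[cite: BDGS2012, §1.3] -/
theorem spineCoord_oddWitness_le {t : ℕ} (ht : t ≤ 2 * k + 4) :
    spineCoord m (oddWitness m k t) ≤ 1 ∧ (t ≤ 2 * k + 3 → spineCoord m (oddWitness m k t) ≤ 0) := by
  rcases oddWitness_zones (m := m) (k := k) (t := t) (by omega) with
      hA | ⟨hB1, hB2⟩ | ⟨s, hs, rfl⟩ | ⟨j', r', hj1, hj2, hr, h⟩ | hE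
  · rw [oddWitness_of_le_succ hA, spineCoord_spinePt]; constructor <;> intros <;> omega
  · rw [oddWitness_leg hB1 hB2, spineCoord_add, spineCoord_spinePt, spineCoord_oddLat]
    constructor <;> intros <;> omega
  · rw [oddWitness_head hs, spineCoord_oddHead]
    have hs1 : s ≤ 1 := by omega
    constructor
    · split_ifs <;> omega
    · intro h; split_ifs <;> omega
  · omega
  · omega

/-- No site before the end equals the end `e₀`. [cite: BDGS2012, §1.3] -/
theorem oddWitness_ne_end {t : ℕ} (ht : t < 2 * k + 6 * m + 9) : oddWitness m k t ≠ spinePt m 1 := by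
  intro heq
  rcases oddWitness_zones (m := m) (k := k) (t := t) (by omega) with
      hA | ⟨hB1, hB2⟩ | ⟨s, hs, rfl⟩ | ⟨j', r', hj1, hj2, hr, rfl⟩ | hE
  · rw [oddWitness_of_le_succ hA] at heq
    have := congrArg (spineCoord m) heq
    simp only [spineCoord_spinePt] at this; omega
  · rw [oddWitness_leg hB1 hB2] at heq
    have := congrArg (spineCoord m) heq
    simp only [spineCoord_add, spineCoord_spinePt, spineCoord_oddLat] at this; omega
  · rw [oddWitness_head hs] at heq
    have h1 := congrArg (spineCoord m) heq
    have h2 := congrArg (oddFun m 0) heq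
    have h3 := congrArg (oddFun m 1) heq
    rw [spineCoord_oddHead, spineCoord_spinePt] at h1
    rw [oddFun_oddHead, oddFun_spinePt] at h2 h3
    simp only [oddFun_oddLat_self] at h2 h3
    split_ifs at h1 h2 h3 <;> omega
  · rw [oddWitness_rung hj1 hj2 hr] at heq
    have := congrArg (oddFun m j') heq
    rw [oddFun_oddRung_self hj1 hj2, oddFun_spinePt] at this
    omega
  · omega

/-- **The odd witness never revisits a site on `[0, 6m + 9 + 2k]`.** [cite: BDGS2012, §1.3] -/
theorem oddWitness_ne {t t' : ℕ} (htt : t' < t) (ht : t ≤ 2 * k + 6 * m + 9) :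
    oddWitness m k t' ≠ oddWitness m k t := by
  intro heq
  have hX := congrArg (spineCoord m) heq
  rcases oddWitness_zones (m := m) (k := k) (t := t) ht with
      hA | ⟨hB1, hB2⟩ | ⟨s, hs, rfl⟩ | ⟨j, r, hj1, hj2, hr, rfl⟩ | rfl
  · -- spine: the spine coordinate `-t` is injective
    rw [oddWitness_of_le_succ hA, oddWitness_of_le_succ (show t' ≤ k + 1 by omega)] at hX
    simp only [spineCoord_spinePt] at hX; omega
  · rw [oddWitness_leg hB1 hB2] at heq hX
    rcases Nat.lt_or_ge t' (k + 2) with h | h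
    · -- earlier spine site: lateral functional `0` differs from `1`
      have := congrArg (oddFun m 0) heq
      rw [oddWitness_of_le_succ (by omega)] at this
      simp at this
    · rw [oddWitness_leg h (by omega)] at hX
      simp only [spineCoord_add, spineCoord_spinePt, spineCoord_oddLat] at hX; omega
  · -- head sites
    have hF0 := congrArg (oddFun m 0) heq
    have hF1 := congrArg (oddFun m 1) heq
    rw [oddWitness_head hs] at hX hF0 hF1
    rw [spineCoord_oddHead] at hX
    rw [oddFun_oddHead] at hF0 hF1
    simp only [oddFun_oddLat_self] at hF0
    have hneg : oddFun m 1 (oddLat m 0) ≤ 0 := oddFun_oddLat_le (by omega) (by omega) (by omega)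
    have hneg' : oddFun m 0 (oddLat m 1) ≤ 0 := oddFun_oddLat_le (by omega) (by omega) (by omega)
    -- statistics of the earlier site `t'`
    have hX' := spineCoord_oddWitness_le (m := m) (k := k) (t := t')
    have hF1' := oddFun_one_oddWitness_nonpos (m := m) (k := k) (t := t')
    rcases oddWitness_zones (m := m) (k := k) (t := t') (by omega) with
        hA' | ⟨hB1', hB2'⟩ | ⟨s', hs', rfl⟩ | ⟨j', r', hj1', hj2', hr', h'⟩ | hE'
    · rw [oddWitness_of_le_succ hA'] at hX hF0 hF1
      simp only [spineCoord_spinePt, oddFun_spinePt] at hX hF0 hF1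
      split_ifs at hX hF0 hF1 <;> omega
    · rw [oddWitness_leg hB1' hB2'] at hX hF0
      simp only [spineCoord_add, spineCoord_spinePt, spineCoord_oddLat, oddFun_add, oddFun_spinePt,
        oddFun_oddLat_self] at hX hF0
      split_ifs at hX hF0 <;> omega
    · rw [oddWitness_head hs'] at hX hF0 hF1
      rw [spineCoord_oddHead] at hX
      rw [oddFun_oddHead] at hF0 hF1
      simp only [oddFun_oddLat_self] at hF0 hF1
      split_ifs at hX hF0 hF1 <;> omega
    · omega
    · omega
  · -- rung `j`, position `r`
    have hFj := congrArg (oddFun m j) heq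
    have hFp := congrArg (oddFun m (j - 1)) heq
    rw [oddWitness_rung hj1 hj2 hr] at hX hFj hFp
    rw [oddFun_oddRung_self hj1 hj2] at hFj
    rw [oddFun_pred_oddRung hj1 hj2] at hFp
    rw [spineCoord_oddRung] at hX
    rcases Nat.lt_or_ge t' (2 * k + 3 * j + 3) with h | h
    · -- before the rung: `oddFun j ≤ 0`
      have := oddFun_oddWitness_nonpos (m := m) (k := k) hj1 hj2 h
      omega
    · -- inside the same rung: `t' = T_j + r'` with `r' < r`
      obtain ⟨r', hr', rfl⟩ : ∃ r', r' < r ∧ t' = 2 * k + 3 * j + 3 + r' := ⟨t' - (2 * k + 3 * j + 3), by omega, by omega⟩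
      rw [oddWitness_rung hj1 hj2 (by omega), oddFun_pred_oddRung hj1 hj2] at hFp
      rw [oddWitness_rung hj1 hj2 (by omega), spineCoord_oddRung] at hX
      split_ifs at hFp hX <;> omega
  · exact oddWitness_ne_end htt (heq.trans (oddWitness_of_ge le_rfl))


/-! #### Consecutive sites are adjacent -/

/-- Values of `oddRung` (even rung). [cite: BDGS2012, §1.3] -/
theorem oddRung_even {j : ℕ} (hj : j % 2 = 0) :
    oddRung m j 0 = spinePt m 1 + oddLat m (j - 1) + oddLat m j ∧
      oddRung m j 1 = spinePt m 1 + oddLat m j ∧ oddRung m j 2 = oddLat m j := by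
  simp [oddRung, hj]

/-- Values of `oddRung` (odd rung). [cite: BDGS2012, §1.3] -/
theorem oddRung_odd {j : ℕ} (hj : j % 2 = 1) :
    oddRung m j 0 = oddLat m (j - 1) + oddLat m j ∧
      oddRung m j 1 = oddLat m j ∧ oddRung m j 2 = spinePt m 1 + oddLat m j := by
  simp [oddRung, hj]

/-- **Consecutive sites of the odd witness are lattice neighbours.** [cite: BDGS2012, §1.3] -/
theorem oddWitness_adj {i : ℕ} (hi : i < 2 * k + 6 * m + 9) :
    (zdGraph (m + 2)).Adj (oddWitness m k i) (oddWitness m k (i + 1)) := by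
  rcases oddWitness_zones (m := m) (k := k) (t := i) hi.le with
      hA | ⟨hB1, hB2⟩ | ⟨s, hs, rfl⟩ | ⟨j, r, hj1, hj2, hr, rfl⟩ | hE
  · rcases Nat.lt_or_ge i (k + 1) with h | h
    · -- spine, going out
      rw [oddWitness_of_le_succ hA, oddWitness_of_le_succ (by omega : i + 1 ≤ k + 1),
        show spinePt m (-(i : ℤ)) = spinePt m (-((i + 1 : ℕ) : ℤ)) + spinePt m 1 by
          rw [spinePt_add]; congr 1; push_cast; ring]
      exact adj_add_spinePt_one' _
    · -- turn into the first lateral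
      have hi' : i = k + 1 := by omega
      subst hi'
      rw [oddWitness_of_le_succ le_rfl, oddWitness_leg (by omega) (by omega),
        show ((k + 1 + 1 : ℕ) : ℤ) - (2 * k + 3) = -((k + 1 : ℕ) : ℤ) by push_cast; ring]
      exact adj_add_latVec _ _
  · rcases Nat.lt_or_ge i (2 * k + 2) with h | h
    · -- return leg
      rw [oddWitness_leg hB1 hB2, oddWitness_leg (by omega) (by omega),
        show spinePt m (((i + 1 : ℕ) : ℤ) - (2 * k + 3)) + oddLat m 0 =
          spinePt m ((i : ℤ) - (2 * k + 3)) + oddLat m 0 + spinePt m 1 by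
          rw [add_right_comm, spinePt_add]; congr 2; push_cast; ring]
      exact adj_add_spinePt_one _
    · -- arrive at `e₁`
      have hi' : i = 2 * k + 2 := by omega
      subst hi'
      rw [oddWitness_leg hB1 hB2, show 2 * k + 2 + 1 = 2 * k + 3 + 0 by omega, oddWitness_head (by omega)]
      simp only [oddHead, if_true]
      rw [show ((2 * k + 2 : ℕ) : ℤ) - (2 * k + 3) = -1 by push_cast; ring]
      have h := adj_add_spinePt_one (spinePt m (-1) + oddLat m 0)
      rwa [add_right_comm (spinePt m (-1)) (oddLat m 0) (spinePt m 1), spinePt_add,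
        show (-1 : ℤ) + 1 = 0 by norm_num, spinePt_zero, zero_add] at h
  · rcases Nat.lt_or_ge s 5 with h | h
    · -- inside the head
      rw [show 2 * k + 3 + s + 1 = 2 * k + 3 + (s + 1) by omega, oddWitness_head hs,
        oddWitness_head (by omega)]
      have h0 : s = 0 ∨ s = 1 ∨ s = 2 ∨ s = 3 ∨ s = 4 := by omega
      rcases h0 with rfl | rfl | rfl | rfl | rfl
      · simp only [oddHead]; simp only [show (0:ℕ) + 1 = 1 by rfl, if_true, one_ne_zero, if_false]
        rw [add_comm (spinePt m 1) (oddLat m 0)]; exact adj_add_spinePt_one _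
      · simp only [oddHead, if_true, show (1:ℕ) + 1 = 2 by rfl, show (2:ℕ) ≠ 0 by decide,
          show (2:ℕ) ≠ 1 by decide, show (1:ℕ) ≠ 0 by decide, if_false]
        rw [show spinePt m 2 + oddLat m 0 = spinePt m 1 + oddLat m 0 + spinePt m 1 by
          rw [add_right_comm, spinePt_add]; norm_num]
        exact adj_add_spinePt_one _
      · simp only [oddHead, if_true, show (2:ℕ) + 1 = 3 by rfl, show (3:ℕ) ≠ 0 by decide,
          show (3:ℕ) ≠ 1 by decide, show (3:ℕ) ≠ 2 by decide, show (2:ℕ) ≠ 0 by decide,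
          show (2:ℕ) ≠ 1 by decide, if_false]
        exact adj_add_latVec' _ _
      · simp only [oddHead, if_true, show (3:ℕ) + 1 = 4 by rfl, show (4:ℕ) ≠ 0 by decide,
          show (4:ℕ) ≠ 1 by decide, show (4:ℕ) ≠ 2 by decide, show (4:ℕ) ≠ 3 by decide,
          show (3:ℕ) ≠ 0 by decide, show (3:ℕ) ≠ 1 by decide, show (3:ℕ) ≠ 2 by decide, if_false]
        exact adj_add_latVec _ _
      · simp only [oddHead, show (4:ℕ) + 1 = 5 by rfl, show (5:ℕ) ≠ 0 by decide,
          show (5:ℕ) ≠ 1 by decide, show (5:ℕ) ≠ 2 by decide, show (5:ℕ) ≠ 3 by decide,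
          show (5:ℕ) ≠ 4 by decide, show (4:ℕ) ≠ 0 by decide, show (4:ℕ) ≠ 1 by decide,
          show (4:ℕ) ≠ 2 by decide, show (4:ℕ) ≠ 3 by decide, if_false, if_true]
        rw [show spinePt m 2 + oddLat m 1 = spinePt m 1 + oddLat m 1 + spinePt m 1 by
          rw [add_right_comm, spinePt_add]; norm_num]
        exact adj_add_spinePt_one' _
    · -- leave the head: into rung 2, or (for `m = 0`) into the end `e₀`
      have hs5 : s = 5 := by omega
      subst hs5
      rw [oddWitness_head hs]
      simp only [oddHead, show (5:ℕ) ≠ 0 by decide, show (5:ℕ) ≠ 1 by decide,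
        show (5:ℕ) ≠ 2 by decide, show (5:ℕ) ≠ 3 by decide, show (5:ℕ) ≠ 4 by decide, if_false]
      rcases Nat.eq_zero_or_pos m with rfl | hm
      · rw [oddWitness_of_ge (by omega)]
        exact adj_add_latVec' _ _
      · rw [show 2 * k + 3 + 5 + 1 = 2 * k + 3 * 2 + 3 + 0 by ring, oddWitness_rung le_rfl (by omega) (by omega),
          (oddRung_even (show 2 % 2 = 0 by rfl)).1]
        exact adj_add_latVec _ _
  · rcases Nat.lt_or_ge r 2 with h | h
    · -- inside rung `j`
      rw [show 2 * k + 3 * j + 3 + r + 1 = 2 * k + 3 * j + 3 + (r + 1) by omega, oddWitness_rung hj1 hj2 hr,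
        oddWitness_rung hj1 hj2 (by omega)]
      rcases Nat.mod_two_eq_zero_or_one j with hj | hj
      · obtain ⟨h0, h1, h2⟩ := oddRung_even (m := m) hj
        rcases Nat.lt_or_ge r 1 with hr0 | hr1
        · obtain rfl : r = 0 := by omega
          rw [h0, h1, add_right_comm (spinePt m 1) (oddLat m (j - 1)) (oddLat m j)]
          exact adj_add_latVec' _ _
        · obtain rfl : r = 1 := by omega
          rw [h1, h2, add_comm (spinePt m 1) (oddLat m j)]; exact adj_add_spinePt_one' _
      · obtain ⟨h0, h1, h2⟩ := oddRung_odd (m := m) hj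
        rcases Nat.lt_or_ge r 1 with hr0 | hr1
        · obtain rfl : r = 0 := by omega
          rw [h0, h1, add_comm (oddLat m (j - 1)) (oddLat m j)]; exact adj_add_latVec' _ _
        · obtain rfl : r = 1 := by omega
          rw [h1, h2, add_comm (spinePt m 1) (oddLat m j)]; exact adj_add_spinePt_one _
    · -- leave rung `j`: into rung `j + 1`, or (for `j = 2m+1`) into the end `e₀`
      obtain rfl : r = 2 := by omega
      rw [oddWitness_rung hj1 hj2 hr]
      rcases Nat.lt_or_ge j (2 * m + 1) with hj3 | hj3
      · rw [show 2 * k + 3 * j + 3 + 2 + 1 = 2 * k + 3 * (j + 1) + 3 + 0 by ring,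
          oddWitness_rung (by omega) (by omega) (by omega)]
        rcases Nat.mod_two_eq_zero_or_one j with hj | hj
        · rw [(oddRung_even hj).2.2, (oddRung_odd (show (j + 1) % 2 = 1 by omega)).1, Nat.add_sub_cancel]
          exact adj_add_latVec _ _
        · rw [(oddRung_odd hj).2.2, (oddRung_even (show (j + 1) % 2 = 0 by omega)).1, Nat.add_sub_cancel]
          exact adj_add_latVec _ _
      · have hj4 : j = 2 * m + 1 := by omega
        rw [oddWitness_of_ge (by omega), (oddRung_odd (by omega)).2.2]
        exact adj_add_latVec' _ _
  · omega

/-! #### The cage of the end and the neighbours of the start -/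

/-- A unit coordinate vector of `ℤ^{m+2}` is `e₀` or one of the laterals `oddLat`. [cite: MadrasSlade1993, §1.1] -/
theorem single_eq_oddLat (a : Fin (m + 2)) :
    (((a : ℕ) = 0 ∧ Pi.single a (1 : ℤ) = spinePt m 1) ∨
      (1 ≤ (a : ℕ) ∧ Pi.single a (1 : ℤ) = oddLat m (a - 1) ∧ -Pi.single a (1 : ℤ) = oddLat m (a + m))) := by
  rcases Nat.eq_zero_or_pos a with h | h
  · refine Or.inl ⟨h, ?_⟩
    have : a = axisFin m 0 := Fin.ext (by rw [axisFin_val (by omega)]; exact h)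
    rw [this]; rfl
  · refine Or.inr ⟨h, ?_, ?_⟩
    · have ha : axisFin m (1 + (a - 1)) = a := Fin.ext (by rw [axisFin_val (by omega)]; omega)
      simp [oddLat, latVec, show (a : ℕ) - 1 < m + 1 by omega, ha]
    · have ha : axisFin m (1 + (a + m) - (m + 1)) = a := Fin.ext (by rw [axisFin_val (by omega)]; omega)
      simp [oddLat, latVec, show ¬ (a : ℕ) + m < m + 1 by omega, ha]

/-- Every site `e₀ + oddLat j` is visited. [cite: BDGS2012, §1.3] -/
theorem exists_oddWitness_eq_spine_add {j : ℕ} (hj : j ≤ 2 * m + 1) :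
    ∃ i < 2 * k + 6 * m + 9 + 1, oddWitness m k i = spinePt m 1 + oddLat m j := by
  rcases Nat.lt_or_ge j 2 with h | h
  · rcases Nat.lt_or_ge j 1 with h1 | h1
    · obtain rfl : j = 0 := by omega
      exact ⟨2 * k + 3 + 1, by omega, by rw [oddWitness_head (by omega)]; simp [oddHead]⟩
    · obtain rfl : j = 1 := by omega
      exact ⟨2 * k + 3 + 5, by omega, by rw [oddWitness_head (by omega)]; simp [oddHead]⟩
  · rcases Nat.mod_two_eq_zero_or_one j with hj2 | hj2
    · exact ⟨2 * k + 3 * j + 3 + 1, by omega, by rw [oddWitness_rung h hj (by omega), (oddRung_even hj2).2.1]⟩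
    · exact ⟨2 * k + 3 * j + 3 + 2, by omega, by rw [oddWitness_rung h hj (by omega), (oddRung_odd hj2).2.2]⟩

/-- Every lateral `oddLat j`, `j ≠ 1`, is visited (`oddLat 1` is the free start site). [cite: BDGS2012, §1.3] -/
theorem exists_oddWitness_eq_lat {j : ℕ} (hj : j ≤ 2 * m + 1) (hj1 : j ≠ 1) :
    ∃ i < 2 * k + 6 * m + 9 + 1, oddWitness m k i = oddLat m j := by
  rcases Nat.lt_or_ge j 2 with h | h
  · obtain rfl : j = 0 := by omega
    exact ⟨2 * k + 3 + 0, by omega, by rw [oddWitness_head (by omega)]; simp [oddHead]⟩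
  · rcases Nat.mod_two_eq_zero_or_one j with hj2 | hj2
    · exact ⟨2 * k + 3 * j + 3 + 2, by omega, by rw [oddWitness_rung h hj (by omega), (oddRung_even hj2).2.2]⟩
    · exact ⟨2 * k + 3 * j + 3 + 1, by omega, by rw [oddWitness_rung h hj (by omega), (oddRung_odd hj2).2.1]⟩

/-- **The odd witness is doubly trapped**: a `(6m + 9 + 2k)`-step self-avoiding walk on `ℤ^{m+2}`
from `0` whose end `e₀` has all `2(m+2)` neighbours on the walk and whose start has the single free
neighbour `oddLat m 1`. [cite: BDGS2012, §1.3] -/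
theorem oddWitness_mem_doublyTrapped (m k : ℕ) :
    oddWitness m k ∈ doublyTrapped (m + 2) (2 * k + 6 * m + 9) := by
  have hn : oddWitness m k (2 * k + 6 * m + 9) = spinePt m 1 := oddWitness_of_ge le_rfl
  refine mem_doublyTrapped_of_forall ?_ ?_ (fun i hi => oddWitness_adj hi) ?_ ?_ (oddLat m 1) ?_
  · rw [oddWitness_of_le_succ (Nat.zero_le _)]; simp
  · intro i hi; rw [oddWitness_of_ge hi, hn]
  · intro i hi j hj hij
    rcases lt_trichotomy i j with h | h | h
    · exact absurd hij (oddWitness_ne h (by omega))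
    · exact h
    · exact absurd hij.symm (oddWitness_ne h (by omega))
  · intro a
    rw [hn]
    rcases single_eq_oddLat (m := m) a with ⟨-, ha⟩ | ⟨ha1, ha, ha'⟩
    · rw [ha, spinePt_add, sub_self]
      refine ⟨⟨2 * k + 3 + 3, by omega, ?_⟩, ⟨0, by omega, ?_⟩⟩
      · rw [oddWitness_head (by omega)]; simp [oddHead]
      · rw [oddWitness_of_le_succ (Nat.zero_le _)]; simp
    · rw [sub_eq_add_neg, ha', ha]
      exact ⟨exists_oddWitness_eq_spine_add (by omega), exists_oddWitness_eq_spine_add (by omega)⟩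
  · intro a
    rcases single_eq_oddLat (m := m) a with ⟨-, ha⟩ | ⟨ha1, ha, ha'⟩
    · rw [ha]
      refine ⟨Or.inl ⟨2 * k + 6 * m + 9, by omega, hn⟩, Or.inl ⟨1, by omega, ?_⟩⟩
      rw [oddWitness_of_le_succ (by omega)]; simp only [spinePt, Nat.cast_one, Pi.single_neg]
    · rw [ha', ha]
      constructor
      · by_cases h1 : (a : ℕ) - 1 = 1
        · exact Or.inr (by rw [h1])
        · exact Or.inl (exists_oddWitness_eq_lat (by omega) h1)
      · by_cases h1 : (a : ℕ) + m = 1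
        · exact Or.inr (by rw [h1])
        · exact Or.inl (exists_oddWitness_eq_lat (by omega) h1)

end OddWitness

/-! ### The odd half of the threshold law, in every dimension -/

/-- **Doubly trapped walks exist at every odd length `n ≥ 6d - 3`, in every dimension `d ≥ 2`.**
[cite: BDGS2012, §1.3] -/
theorem doublyTrapped_nonempty_of_odd {d n : ℕ} (hd : 2 ≤ d) (hn : Odd n) (h : 6 * d ≤ n + 3) :
    (doublyTrapped d n).Nonempty := by
  obtain ⟨m, rfl⟩ : ∃ m, d = m + 2 := ⟨d - 2, by omega⟩
  obtain ⟨a, ha⟩ := hn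
  obtain ⟨k, rfl⟩ : ∃ k, n = 2 * k + 6 * m + 9 := ⟨(n - (6 * m + 9)) / 2, by omega⟩
  exact ⟨_, oddWitness_mem_doublyTrapped m k⟩

/-- **The odd half of the doubly trapped threshold law**: for `d ≥ 2` and odd `n`,
`T₂(d, n) = ∅ ↔ n ≤ 6d - 5`. So at odd lengths the reversal pairing `cₙ ≤ cₙ₊₁ + #T₂` yields O'Brien's
inequality exactly for `n ≤ 6d - 5`. [cite: BDGS2012, §1.3] -/
theorem doublyTrapped_eq_empty_iff_of_odd {d n : ℕ} (hd : 2 ≤ d) (hn : Odd n) :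
    doublyTrapped d n = ∅ ↔ n + 5 ≤ 6 * d := by
  refine ⟨fun h => ?_, fun h => doublyTrapped_eq_empty_of_odd hn h⟩
  by_contra h'
  obtain ⟨a, ha⟩ := hn
  exact (doublyTrapped_nonempty_of_odd hd ⟨a, ha⟩ (by omega)).ne_empty h

/-- At the odd threshold itself: **`T₂(d, 6d - 3) ≠ ∅` for every `d ≥ 2`** (stated with
`n + 3 = 6d`). [cite: BDGS2012, §1.3] -/
theorem doublyTrapped_nonempty_odd_threshold {d n : ℕ} (hd : 2 ≤ d) (hn : n + 3 = 6 * d) :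
    (doublyTrapped d n).Nonempty :=
  doublyTrapped_nonempty_of_odd hd ⟨3 * d - 2, by omega⟩ (by omega)




end Literature.Probability.RandomPlanarGeometry.SAW.Zd
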